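import Mathlib
import Literature.AlgebraicGeometry.Resolution.AffineDomainEquidim
import HarnessLib

/-!
# Lens-5 THEOREM T, §4′ — an elementary REGULARITY CRITERION replacing (ET)/(TOR)/(RSP) of memo §4

Crux `stmt-ResolutionOfSingularities-0549` (`Theses.Descent.DescentPerfectToAll`), lineage res-B-lens-5, g9.  Counted 0; nothing here
proves resolution in char p; resolution in char p NOT proved.  Def-free, Mathlib-only.

## The simplification (memo §4 → §4′)

Memo §4 proved that the toric chart ring `S_τ = T[u_{≤ρ}, u_{>ρ}^{±1}]_𝔮 = locAtCentre A'' O` is regular with r.s.p. `(u_{≤ρ}, ψ_{>ρ}(u))`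
via étale straightening of the twist units (ET), the toric smoothness transfer (TOR) and faithfully flat descent (RSP) — the port's "L piece".
NONE OF THAT IS NEEDED.  Put `𝔞 := (u₁,…,u_ρ) S`.  Two facts the port has cheaply:
* `𝔪_T S ⊆ 𝔞` — each parameter `z_i` of `T` is a `T`-unit times a `u`-monomial with a POSITIVE exponent on some `u_j`, `j ≤ ρ`
  (the positivity clause of `toric_lemma_classB`: `z_i`'s exponent lies in `F`);
* hence `S ⧸ 𝔞` is a localisation of a quotient of the Laurent ring `κ_T[U_{>ρ}^{±1}]`, i.e. there is a SURJECTION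
  `f : P := κ_T[U]_𝔫 ↠ S ⧸ 𝔞` from the local ring of the polynomial ring `κ_T[U_{ρ+1},…,U₃]` at the maximal ideal `𝔫` = kernel of
  `U ↦ ū ∈ κ_S` (`ū` algebraic over `k ⊆ κ_T` because the centre is closed, (hzd)); `P` is a regular local DOMAIN of dimension `3 − ρ`
  (Mathlib: `MvPolynomial.isRegularRing_of_isRegularRing`, localisation of a regular ring; dimension by the tree's
  `ringKrullDim_localization_atPrime_eq_of_isMaximal`).
Then the criterion below gives, from `dim S = 3` alone: `f` is an ISOMORPHISM (Krull: `dim S⧸𝔞 ≥ 3 − ρ = dim P`, and a proper quotient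
of a local domain has smaller dimension), `𝔪_S = 𝔞 + (lifts of generators of 𝔪_P)` has `ρ + (3 − ρ) = 3 = dim S` generators, so
`S` IS REGULAR, and the lift `ψ ∈ T[u_{>ρ}] ⊂ M` of any regular parameter `π ∈ 𝔪_P ∖ 𝔪_P²` is a regular parameter of `S`
(`ψ ∈ 𝔪_S ∖ 𝔪_S²`) — exactly the input of the exit lemma `Census_lens5_pRankTwo.cleanLUConcl_of_parameter` (FORM (3), `c′ = 0`),
since `ψ ∈ M = K^p(g₀)` (coefficients in `T ⊂ M`, value-zero monomials `u_{>ρ} ∈ M` by (PB0)).  No étale maps, no flatness, no (SEP-κ).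

## Contents
* `exists_nat_eq_of_le_nat` — bookkeeping in `WithBot ℕ∞`.
* `injective_of_surjective_of_ringKrullDim_le` — a surjection from a local DOMAIN of finite dimension `d` onto a ring of dimension `≥ d`
  is injective (`ringKrullDim_quotient_succ_le_of_nonZeroDivisor`).
* `regular_of_regular_quotient` — THE CRITERION: `S` Noetherian local of dimension `n`, `u : Fin ρ → 𝔪_S`, `P` a regular local domain of
  dimension `n − ρ` (`ρ ≤ n`) with a surjection `f : P ↠ S ⧸ (u)`; then `S` is regular, `f` is injective, `𝔪_{S⧸(u)} = f(𝔪_P)`, and lifts of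
  elements of `𝔪_P ∖ 𝔪_P²` lie in `𝔪_S ∖ 𝔪_S²`; primed version `regular_of_regular_quotient'` for an abstract ideal `𝔞` with `≤ ρ` generators.
* `mvPolynomial_localization_regular` — the `P` of the application: `κ[U₁,…,U_m]_𝔫` (`𝔫` maximal) is a regular local domain of dimension `m`.
* (rev 2) `exists_mem_span_not_mem_sq` / `exists_generator_map_not_mem_sq` — memo §13 (f): among any generators of `𝔫` (so of `𝔪_P = 𝔫P`) one
  maps outside `𝔪_P²` when `dim P ≠ 0` (Nakayama, Mathlib `IsLocalRing.maximalIdeal_sq_lt_of_ringKrullDim_ne_zero`).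
-/

set_option linter.dupNamespace false

namespace Summit.ResolutionOfSingularities.ResolutionOfSingularities.Cruxes.DescentPerfectToAll.CpSibling.RegularityCriterion

open IsLocalRing

/-- `WithBot ℕ∞` bookkeeping: a dimension which is not `⊥` and is bounded by a natural number is a natural number. -/
theorem exists_nat_eq_of_le_nat (x : WithBot ℕ∞) (hbot : x ≠ ⊥) (N : ℕ) (hle : x ≤ (N : WithBot ℕ∞)) : ∃ m : ℕ, x = m := by
  induction x using WithBot.recBotCoe with
  | bot => exact absurd rfl hbot
  | coe y =>
    induction y using ENat.recTopCoe with
    | top =>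
      exfalso
      have h : ((⊤ : ℕ∞) : WithBot ℕ∞) ≤ ((N : ℕ∞) : WithBot ℕ∞) := hle
      rw [WithBot.coe_le_coe] at h
      exact absurd h (not_le.mpr (ENat.coe_lt_top N))
    | coe m => exact ⟨m, rfl⟩

/-- A surjection from a local domain of finite Krull dimension `d` onto a ring of dimension `≥ d` is injective. -/
theorem injective_of_surjective_of_ringKrullDim_le {P Q : Type} [CommRing P] [IsDomain P] [CommRing Q]
    (f : P →+* Q) (hf : Function.Surjective f) {d : ℕ} (hP : ringKrullDim P = d) (hQ : (d : WithBot ℕ∞) ≤ ringKrullDim Q) :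
    Function.Injective f := by
  rw [injective_iff_map_eq_zero]
  intro r hr
  by_contra hr0
  -- `Q` is a quotient of `P ⧸ (r)`
  let g : P ⧸ Ideal.span {r} →+* Q :=
    Ideal.Quotient.lift (Ideal.span {r}) f fun a ha => by
      obtain ⟨c, rfl⟩ := Ideal.mem_span_singleton'.mp ha
      rw [map_mul, hr, mul_zero]
  have hg : Function.Surjective g := by
    intro q
    obtain ⟨p, rfl⟩ := hf q
    exact ⟨Ideal.Quotient.mk _ p, by simp [g]⟩
  have h1 : ringKrullDim Q ≤ ringKrullDim (P ⧸ Ideal.span {r}) := ringKrullDim_le_of_surjective g hg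
  have h2 : ringKrullDim (P ⧸ Ideal.span {r}) + 1 ≤ ringKrullDim P :=
    ringKrullDim_quotient_succ_le_of_nonZeroDivisor (mem_nonZeroDivisors_of_ne_zero hr0)
  rw [hP] at h2
  have h3 : (d : WithBot ℕ∞) + 1 ≤ d := le_trans (add_le_add (hQ.trans h1) le_rfl) h2
  have h4 : ((d + 1 : ℕ) : WithBot ℕ∞) ≤ ((d : ℕ) : WithBot ℕ∞) := by push_cast; exact h3
  have h5 : d + 1 ≤ d := by exact_mod_cast h4
  omega

/-- In a local ring, an ideal contained in the maximal ideal is contained in the Jacobson radical. -/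
theorem le_jacobson_of_le_maximalIdeal {S : Type} [CommRing S] [IsLocalRing S] (𝔞 : Ideal S) (h : 𝔞 ≤ maximalIdeal S) :
    𝔞 ≤ Ring.jacobson S := by
  rw [Ring.jacobson_eq_sInf_isMaximal]
  refine le_sInf fun I hI => ?_
  haveI : I.IsMaximal := hI
  rw [IsLocalRing.eq_maximalIdeal hI]
  exact h

/-- **THE REGULARITY CRITERION (§4′), abstract ideal.**  `S` Noetherian local of dimension `n`; `𝔞 ⊆ 𝔪_S` generated by `≤ ρ` elements
(`ρ ≤ n`); `P` a regular local domain of dimension `n − ρ` with a surjection `f : P ↠ S ⧸ 𝔞`.  Then `S` is regular, `f` is injective, the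
maximal ideal of the quotient is `f(𝔪_P)` and is the image of `𝔪_S`, and the lift of a regular parameter of `P` is a regular parameter of `S`. -/
theorem regular_of_regular_quotient' {S : Type} [CommRing S] [IsLocalRing S] [IsNoetherianRing S] {n ρ : ℕ}
    (hdim : ringKrullDim S = n) (hρn : ρ ≤ n) (𝔞 : Ideal S) (h𝔞m : 𝔞 ≤ maximalIdeal S) (hgen : 𝔞.spanFinrank ≤ ρ)
    {P : Type} [CommRing P] [IsDomain P] [IsRegularLocalRing P] (hP : ringKrullDim P = (n - ρ : ℕ))
    (f : P →+* S ⧸ 𝔞) (hf : Function.Surjective f) :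
    IsRegularLocalRing S ∧ Function.Injective f ∧
      (maximalIdeal S).map (Ideal.Quotient.mk 𝔞) = (maximalIdeal P).map f ∧
      (∀ (ψ : S) (π : P), Ideal.Quotient.mk 𝔞 ψ = f π → π ∈ maximalIdeal P → ψ ∈ maximalIdeal S) ∧
      (∀ (ψ : S) (π : P), Ideal.Quotient.mk 𝔞 ψ = f π → π ∉ (maximalIdeal P) ^ 2 → ψ ∉ (maximalIdeal S) ^ 2) := by
  classical
  have h𝔞top : 𝔞 ≠ ⊤ := fun h => (maximalIdeal.isMaximal S).ne_top (top_le_iff.mp (h ▸ h𝔞m))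
  haveI : Nontrivial (S ⧸ 𝔞) := Ideal.Quotient.nontrivial_iff.mpr h𝔞top
  haveI : IsLocalRing (S ⧸ 𝔞) := IsLocalRing.of_surjective' (Ideal.Quotient.mk 𝔞) Ideal.Quotient.mk_surjective
  -- (1) `dim (S ⧸ 𝔞) ≥ n - ρ`
  have hKrull : ringKrullDim S ≤ ringKrullDim (S ⧸ 𝔞) + 𝔞.spanFinrank :=
    ringKrullDim_le_ringKrullDim_quotient_add_spanFinrank 𝔞 (le_jacobson_of_le_maximalIdeal 𝔞 h𝔞m)
  have hQle : ringKrullDim (S ⧸ 𝔞) ≤ (n : WithBot ℕ∞) := hdim ▸ ringKrullDim_le_of_surjective _ Ideal.Quotient.mk_surjective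
  have hQbot : ringKrullDim (S ⧸ 𝔞) ≠ ⊥ := by
    have h0 : (0 : WithBot ℕ∞) ≤ ringKrullDim (S ⧸ 𝔞) := ringKrullDim_nonneg_of_nontrivial
    intro h
    rw [h] at h0
    exact absurd h0 (by simp)
  obtain ⟨m, hm⟩ := exists_nat_eq_of_le_nat _ hQbot n hQle
  have hnm : n ≤ m + ρ := by
    rw [hdim, hm] at hKrull
    have h' : (n : WithBot ℕ∞) ≤ (m : WithBot ℕ∞) + (ρ : WithBot ℕ∞) :=
      hKrull.trans (add_le_add le_rfl (by exact_mod_cast hgen))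
    have h'' : ((n : ℕ) : WithBot ℕ∞) ≤ ((m + ρ : ℕ) : WithBot ℕ∞) := by push_cast; exact h'
    exact_mod_cast h''
  have hQge : ((n - ρ : ℕ) : WithBot ℕ∞) ≤ ringKrullDim (S ⧸ 𝔞) := by
    rw [hm]; exact_mod_cast (by omega : n - ρ ≤ m)
  -- (2) `f` is injective, hence an isomorphism of local rings
  have hinj : Function.Injective f := injective_of_surjective_of_ringKrullDim_le f hf hP hQge
  let e : P ≃+* S ⧸ 𝔞 := RingEquiv.ofBijective f ⟨hinj, hf⟩
  have he : ∀ p, e p = f p := fun _ => rfl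
  -- units correspond
  have hunitP : ∀ p : P, IsUnit (f p) ↔ IsUnit p := fun p => by
    constructor
    · intro h
      have := h.map e.symm
      rwa [← he, RingEquiv.symm_apply_apply] at this
    · exact fun h => h.map f
  have hunitS : ∀ s : S, IsUnit (Ideal.Quotient.mk 𝔞 s) ↔ IsUnit s := fun s => by
    constructor
    · intro h
      by_contra hs
      obtain ⟨t, ht⟩ := h.exists_right_inv
      obtain ⟨t', rfl⟩ := Ideal.Quotient.mk_surjective t
      rw [← map_mul, ← map_one (Ideal.Quotient.mk 𝔞), Ideal.Quotient.eq] at ht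
      have h1 : s * t' - 1 ∈ maximalIdeal S := h𝔞m ht
      have h2 : s * t' ∈ maximalIdeal S := Ideal.mul_mem_right _ _ ((mem_maximalIdeal _).mpr (mem_nonunits_iff.mpr hs))
      have h3 : (1 : S) ∈ maximalIdeal S := by simpa using Ideal.sub_mem _ h2 h1
      exact (maximalIdeal.isMaximal S).ne_top (Ideal.eq_top_of_isUnit_mem _ h3 isUnit_one)
    · exact fun h => h.map _
  have hmmP : ∀ p : P, p ∈ maximalIdeal P ↔ f p ∈ maximalIdeal (S ⧸ 𝔞) := fun p => by
    simp only [mem_maximalIdeal, mem_nonunits_iff, hunitP]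
  have hmmS : ∀ s : S, s ∈ maximalIdeal S ↔ Ideal.Quotient.mk 𝔞 s ∈ maximalIdeal (S ⧸ 𝔞) := fun s => by
    simp only [mem_maximalIdeal, mem_nonunits_iff, hunitS]
  -- (3) the maximal ideal of the quotient is `f(𝔪_P)` and is the image of `𝔪_S`
  have hmQ : maximalIdeal (S ⧸ 𝔞) = (maximalIdeal P).map f := by
    apply le_antisymm
    · intro q hq
      obtain ⟨p, rfl⟩ := hf q
      exact Ideal.mem_map_of_mem f ((hmmP p).mpr hq)
    · rw [Ideal.map_le_iff_le_comap]
      intro p hp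
      rw [Ideal.mem_comap]
      exact (hmmP p).mp hp
  have hmS : (maximalIdeal S).map (Ideal.Quotient.mk 𝔞) = maximalIdeal (S ⧸ 𝔞) := by
    apply le_antisymm
    · rw [Ideal.map_le_iff_le_comap]
      intro s hs
      rw [Ideal.mem_comap]
      exact (hmmS s).mp hs
    · intro q hq
      obtain ⟨s, rfl⟩ := Ideal.Quotient.mk_surjective q
      exact Ideal.mem_map_of_mem _ ((hmmS s).mpr hq)
  -- (4) generators: `𝔪_S = (generators of 𝔞) + (lifts of the n - ρ generators of 𝔪_P)`
  have hPfin : (maximalIdeal P).spanFinrank = n - ρ := by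
    have h : ((maximalIdeal P).spanFinrank : WithBot ℕ∞) = ((n - ρ : ℕ) : WithBot ℕ∞) := by
      rw [← hP]; exact IsRegularLocalRing.spanFinrank_maximalIdeal
    exact_mod_cast h
  obtain ⟨G, hGcard, hGspan⟩ :=
    Submodule.FG.exists_span_finset_card_eq_spanFinrank (IsNoetherian.noetherian (maximalIdeal P))
  rw [hPfin] at hGcard
  obtain ⟨A, hAcard, hAspan⟩ := Submodule.FG.exists_span_finset_card_eq_spanFinrank (IsNoetherian.noetherian 𝔞)
  -- lifts
  let ψ : P → S := fun p => (Ideal.Quotient.mk_surjective (f p)).choose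
  have hψ : ∀ p, Ideal.Quotient.mk 𝔞 (ψ p) = f p := fun p => (Ideal.Quotient.mk_surjective (f p)).choose_spec
  let T : Finset S := A ∪ G.image ψ
  have hTcard : T.card ≤ n := by
    calc T.card ≤ A.card + (G.image ψ).card := Finset.card_union_le _ _
      _ ≤ 𝔞.spanFinrank + G.card := add_le_add hAcard.le Finset.card_image_le
      _ ≤ ρ + (n - ρ) := add_le_add hgen hGcard.le
      _ = n := by omega
  have h𝔞A : (𝔞 : Ideal S) = Ideal.span (A : Set S) := by rw [← hAspan]
  have h𝔞T : 𝔞 ≤ Ideal.span (T : Set S) := by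
    rw [h𝔞A]; apply Ideal.span_mono
    intro a ha
    exact Finset.mem_coe.mpr (Finset.mem_union_left _ (Finset.mem_coe.mp ha))
  have hTm : Ideal.span (T : Set S) = maximalIdeal S := by
    apply le_antisymm
    · rw [Ideal.span_le]
      intro s hs
      rcases Finset.mem_union.mp (Finset.mem_coe.mp hs) with hA | hG
      · exact h𝔞m (h𝔞A ▸ Ideal.subset_span (Finset.mem_coe.mpr hA))
      · obtain ⟨g, hg, rfl⟩ := Finset.mem_image.mp hG
        have hg' : g ∈ maximalIdeal P := by
          have : g ∈ Submodule.span P (G : Set P) := Submodule.subset_span (Finset.mem_coe.mpr hg)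
          rw [hGspan] at this; exact this
        have : f g ∈ maximalIdeal (S ⧸ 𝔞) := (hmmP g).mp hg'
        rw [← hψ g] at this
        exact (hmmS _).mpr this
    · have hmap : (maximalIdeal S).map (Ideal.Quotient.mk 𝔞) ≤ (Ideal.span (T : Set S)).map (Ideal.Quotient.mk 𝔞) := by
        rw [hmS, hmQ, Ideal.map_le_iff_le_comap]
        have hGle : (maximalIdeal P : Ideal P) = Ideal.span (G : Set P) := by
          rw [← hGspan]
        rw [hGle, Ideal.span_le]
        intro g hg
        rw [SetLike.mem_coe, Ideal.mem_comap, ← hψ g]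
        apply Ideal.mem_map_of_mem
        apply Ideal.subset_span
        exact Finset.mem_coe.mpr (Finset.mem_union_right _ (Finset.mem_image_of_mem ψ (Finset.mem_coe.mp hg)))
      have := Ideal.comap_mono (f := Ideal.Quotient.mk 𝔞) hmap
      rw [Ideal.comap_map_of_surjective _ Ideal.Quotient.mk_surjective,
        Ideal.comap_map_of_surjective _ Ideal.Quotient.mk_surjective] at this
      have hker : Ideal.comap (Ideal.Quotient.mk 𝔞) ⊥ = 𝔞 := by
        rw [← RingHom.ker_eq_comap_bot, Ideal.mk_ker]
      rw [hker] at this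
      calc maximalIdeal S ≤ maximalIdeal S ⊔ 𝔞 := le_sup_left
        _ ≤ Ideal.span (T : Set S) ⊔ 𝔞 := this
        _ = Ideal.span (T : Set S) := sup_eq_left.mpr h𝔞T
  -- (5) regularity
  have hreg : IsRegularLocalRing S := by
    apply IsRegularLocalRing.of_spanFinrank_maximalIdeal_le
    rw [hdim, ← hTm]
    exact_mod_cast (Submodule.spanFinrank_span_le_ncard_of_finite (R := S) (Finset.finite_toSet T)).trans
      (by rw [Set.ncard_coe_finset]; exact hTcard)
  refine ⟨hreg, hinj, by rw [hmS, hmQ], ?_, ?_⟩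
  · intro ψ' π hψ' hπ
    have : f π ∈ maximalIdeal (S ⧸ 𝔞) := (hmmP π).mp hπ
    rw [← hψ'] at this
    exact (hmmS _).mpr this
  · intro ψ' π hψ' hπ hψ'2
    apply hπ
    have h1 : Ideal.Quotient.mk 𝔞 ψ' ∈ ((maximalIdeal S) ^ 2).map (Ideal.Quotient.mk 𝔞) := Ideal.mem_map_of_mem _ hψ'2
    rw [Ideal.map_pow, hmS, hmQ, ← Ideal.map_pow, hψ'] at h1
    have h2 : π ∈ Ideal.comap f (((maximalIdeal P) ^ 2).map f) := by
      rw [Ideal.mem_comap]; exact h1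
    rw [Ideal.comap_map_of_surjective f hf] at h2
    have hker : Ideal.comap f ⊥ = ⊥ := by
      rw [← RingHom.ker_eq_comap_bot]; exact (RingHom.injective_iff_ker_eq_bot f).mp hinj
    rw [hker, sup_bot_eq] at h2
    exact h2

/-- **THE REGULARITY CRITERION (§4′)** for `𝔞 = (u₁,…,u_ρ)`. -/
theorem regular_of_regular_quotient {S : Type} [CommRing S] [IsLocalRing S] [IsNoetherianRing S] {n ρ : ℕ}
    (hdim : ringKrullDim S = n) (hρn : ρ ≤ n) (u : Fin ρ → S) (hu : ∀ i, u i ∈ maximalIdeal S)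
    {P : Type} [CommRing P] [IsDomain P] [IsRegularLocalRing P] (hP : ringKrullDim P = (n - ρ : ℕ))
    (f : P →+* S ⧸ Ideal.span (Set.range u)) (hf : Function.Surjective f) :
    IsRegularLocalRing S ∧ Function.Injective f ∧
      (maximalIdeal S).map (Ideal.Quotient.mk (Ideal.span (Set.range u))) = (maximalIdeal P).map f ∧
      (∀ (ψ : S) (π : P), Ideal.Quotient.mk (Ideal.span (Set.range u)) ψ = f π → π ∈ maximalIdeal P → ψ ∈ maximalIdeal S) ∧
      (∀ (ψ : S) (π : P), Ideal.Quotient.mk (Ideal.span (Set.range u)) ψ = f π → π ∉ (maximalIdeal P) ^ 2 →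
        ψ ∉ (maximalIdeal S) ^ 2) := by
  classical
  refine regular_of_regular_quotient' hdim hρn (Ideal.span (Set.range u)) ?_ ?_ hP f hf
  · rw [Ideal.span_le]
    rintro _ ⟨i, rfl⟩
    exact hu i
  · have hr : Set.range u = ((Finset.univ.image u : Finset S) : Set S) := by ext; simp
    rw [hr]
    refine (Submodule.spanFinrank_span_le_ncard_of_finite (R := S) (Finset.finite_toSet _)).trans ?_
    rw [Set.ncard_coe_finset]
    exact Finset.card_image_le.trans (by simp)

/-- The ring `P` of §4′: the local ring of the polynomial ring `κ[U₁,…,U_m]` over a field at a MAXIMAL ideal is a regular local domain of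
dimension `m` (Mathlib: polynomial rings over regular rings are regular; the tree: affine domains are equidimensional at closed points). -/
theorem mvPolynomial_localization_regular (κ : Type) [Field κ] (m : ℕ) (𝔫 : Ideal (MvPolynomial (Fin m) κ)) [𝔫.IsMaximal] :
    IsRegularLocalRing (Localization.AtPrime 𝔫) ∧ IsDomain (Localization.AtPrime 𝔫) ∧
      ringKrullDim (Localization.AtPrime 𝔫) = m := by
  refine ⟨inferInstance, inferInstance, ?_⟩
  rw [Literature.AlgebraicGeometry.Resolution.ringKrullDim_localization_atPrime_eq_of_isMaximal κ 𝔫,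
    MvPolynomial.ringKrullDim_of_isNoetherianRing, ringKrullDim_eq_zero_of_field]
  simp


/-! ## (rev 2) The lifted parameter exists among ANY generating set of the regular model's maximal ideal

Memo §13 (f): `𝔪_P` is generated by (the images of) finitely many POLYNOMIALS `Π₁,…,Π_r ∈ κ_T[U]` (generators of `𝔫`); at least one
of them is a regular parameter, i.e. lies outside `𝔪_P²` — because `P` has positive dimension (`m = 3 - ρ ≥ 1`), so `𝔪_P² < 𝔪_P`
(Nakayama, Mathlib `IsLocalRing.maximalIdeal_sq_lt_of_ringKrullDim_ne_zero`).  Stated for an arbitrary generating SET. [folklore] -/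

/-- In a Noetherian local ring of non-zero Krull dimension, every generating set of the maximal ideal contains an element outside
`𝔪²` (a member of a minimal generating set / a "regular parameter" when the ring is regular). OURS · CANDIDATE · counted 0. [folklore] -/
theorem exists_mem_span_not_mem_sq {P : Type} [CommRing P] [IsLocalRing P] [IsNoetherianRing P]
    (hdim : ringKrullDim P ≠ 0) (G : Set P) (hG : Ideal.span G = maximalIdeal P) :
    ∃ g ∈ G, g ∈ maximalIdeal P ∧ g ∉ (maximalIdeal P) ^ 2 := by
  by_contra h
  have h' : ∀ g ∈ G, g ∈ (maximalIdeal P) ^ 2 := fun g hg => by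
    by_contra hg2
    exact h ⟨g, hg, hG ▸ Ideal.subset_span hg, hg2⟩
  have hle : maximalIdeal P ≤ (maximalIdeal P) ^ 2 := by
    have : Ideal.span G ≤ (maximalIdeal P) ^ 2 := Ideal.span_le.mpr fun g hg => h' g hg
    rwa [hG] at this
  exact absurd hle (not_le_of_gt (IsLocalRing.maximalIdeal_sq_lt_of_ringKrullDim_ne_zero hdim))

/-- The same through a ring map: if `𝔪_P` is the extension `𝔫.map ι` of an ideal `𝔫 = span G₀` along `ι : R →+* P` (memo §13 (f):
`R = κ_T[U]`, `ι` the localisation map, `G₀` polynomial generators of `𝔫`), some generator `Π ∈ G₀` maps to a regular parameter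
`ι Π ∈ 𝔪_P ∖ 𝔪_P²`. OURS · CANDIDATE · counted 0. [folklore] -/
theorem exists_generator_map_not_mem_sq {R P : Type} [CommRing R] [CommRing P] [IsLocalRing P] [IsNoetherianRing P]
    (hdim : ringKrullDim P ≠ 0) (ι : R →+* P) (G₀ : Set R) (h𝔫 : (Ideal.span G₀).map ι = maximalIdeal P) :
    ∃ q ∈ G₀, ι q ∈ maximalIdeal P ∧ ι q ∉ (maximalIdeal P) ^ 2 := by
  have hG : Ideal.span (ι '' G₀) = maximalIdeal P := by rw [← Ideal.map_span, h𝔫]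
  obtain ⟨g, ⟨q, hq, rfl⟩, h1, h2⟩ := exists_mem_span_not_mem_sq hdim (ι '' G₀) hG
  exact ⟨q, hq, h1, h2⟩

end Summit.ResolutionOfSingularities.ResolutionOfSingularities.Cruxes.DescentPerfectToAll.CpSibling.RegularityCriterion
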